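import Summits.Ventures.PercRepro.ProfileTwoDeletionEasy

/-!
# PercRepro — THE DELETION STEP FROM THE INDUCTION HYPOTHESIS ON THE CONTRACTION (no 2-cocircuit through `z`)
(p10, gen 3; Proposition P of `proofs/P10-IHSTEP.md`, the case `s = 1`, in the kernel)

Let `M` be simple and coloop-free, `z` an element lying in no 2-cocircuit (every pair through `z` has a
spanning complement), with `M / z` simple, and `3 ≤ u ≤ ρ(E) − 1`.  Then `INDEP_{2,u−1}(M / z)` implies
the deletion step `DelStep M z u`.  Mechanism: a pair `B ∌ z` loses demand in `M ∖ z` only if `z` is a coloop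
of `M|(E∖B)`, by exactly `C(ρ−1,u−3)` (the complement keeps rank `≥ ρ−1` because the pairs `{z, b}` have
spanning complements), and each such pair has demand `C(ρ−1,u−3)` in `M / z` at level `u−1`; every pair of
`M / z` has demand `≥ C(ρ−2,u−3)` there; the hypothesis `INDEP_{2,u−1}(M/z)` turns the demand of `M / z` into
independent `(u−1)`-sets of `M / z`, i.e. independent `u`-sets of `M` through `z`; the arithmetic core
`arith_ih_core` closes (the number of pairs avoiding `z` is `C(n−1,2) ≥ (n−1)ρ/2`).  Any number of
3-cocircuits through `z` is allowed (they are the pairs of `T`).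

* `arith_ih_core` — the arithmetic;
* `indepSets_contract_two_eq`, `card_indepSets_one_of_simple` — the pairs and singletons of `M / z`;
* `demand_contract_eq` — the demand of `M / z` at level `u−1`;
* **`delStep_of_indep2_contract_noSeries`** — the step.
-/

open scoped Matroid

namespace PercRepro.Cogirth

open Finset ThmH Skew Shadow Profile

variable {α : Type} [DecidableEq α] {M : Matroid α} [M.Finite]

/-- The arithmetic core of the step, in `K`-units (`K = C(ρ−1,u−3)`): with `(u−2)·C(ρ,u−2) = ρ·K` and
`(ρ−1)·C(ρ−2,u−3) = (ρ−u+2)·K`, the claim is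
`(ρ−1)·m·ρ + (ρ−1)(u−2)·t ≤ u(ρ−1)·t + u(ρ−u+2)(P−t)` for `2P = m(m−1)`, `t ≤ P`, `3 ≤ u ≤ ρ−1 ≤ m−2`:
it holds because `u(ρ−u+2) ≥ 2(ρ−1)` and `2P = m(m−1) ≥ m·ρ`. -/
theorem arith_ih_core {u R m t P : ℕ} (hu : 3 ≤ u) (huR : u + 1 ≤ R) (hRm : R + 1 ≤ m)
    (htP : t ≤ P) (hP : 2 * P = m * (m - 1)) :
    (R - 1) * m * R + (R - 1) * (u - 2) * t ≤ u * (R - 1) * t + u * (R - u + 2) * (P - t) := by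
  obtain ⟨a, rfl⟩ : ∃ a, u = a + 3 := ⟨u - 3, by omega⟩
  obtain ⟨b, rfl⟩ : ∃ b, R = a + 4 + b := ⟨R - (a + 4), by omega⟩
  obtain ⟨c, rfl⟩ : ∃ c, m = a + 5 + b + c := ⟨m - (a + 5 + b), by omega⟩
  obtain ⟨d, rfl⟩ : ∃ d, P = t + d := ⟨P - t, by omega⟩
  simp only [show a + 4 + b - 1 = a + 3 + b by omega, show a + 3 - 2 = a + 1 by omega,
    show a + 4 + b - (a + 3) + 2 = b + 3 by omega, show t + d - t = d by omega,
    show a + 5 + b + c - 1 = a + 4 + b + c by omega] at hP ⊢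
  nlinarith [Nat.zero_le (a * b), Nat.zero_le (a * d), Nat.zero_le (b * d), Nat.zero_le (a * c),
    Nat.zero_le (b * c), Nat.zero_le (c * d), Nat.zero_le (a * a), Nat.zero_le (b * b)]

/-- `(u−2)·C(u,2) = u·C(u−1,2)`. -/
theorem sub_two_mul_choose_two (u : ℕ) (hu : 2 ≤ u) : (u - 2) * u.choose 2 = u * (u - 1).choose 2 := by
  obtain ⟨a, rfl⟩ : ∃ a, u = a + 2 := ⟨u - 2, by omega⟩
  simp only [Nat.add_sub_cancel, show a + 2 - 1 = a + 1 by omega]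
  have h1 : 2 * (a + 2).choose 2 = (a + 2) * (a + 1) := by
    rw [Nat.choose_two_right]
    have := Nat.two_mul_div_two_of_even (Nat.even_mul_pred_self (a + 2))
    simpa [show a + 2 - 1 = a + 1 by omega] using this
  have h2 : 2 * (a + 1).choose 2 = (a + 1) * a := by
    rw [Nat.choose_two_right]
    have := Nat.two_mul_div_two_of_even (Nat.even_mul_pred_self (a + 1))
    simpa [show a + 1 - 1 = a by omega] using this
  apply Nat.eq_of_mul_eq_mul_left (show 0 < 2 by norm_num)
  calc 2 * (a * (a + 2).choose 2) = a * (2 * (a + 2).choose 2) := by ring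
    _ = a * ((a + 2) * (a + 1)) := by rw [h1]
    _ = (a + 2) * ((a + 1) * a) := by ring
    _ = (a + 2) * (2 * (a + 1).choose 2) := by rw [h2]
    _ = 2 * ((a + 2) * (a + 1).choose 2) := by ring

/-- The pairs of `M / z` (simple) are the pairs of `M` avoiding `z`. -/
theorem indepSets_contract_two_eq (hs : Simple' M) {z : α} (hN : Simple' (M ／ ({z} : Set α))) :
    indepSets (M ／ ({z} : Set α)) 2 = (indepSets M 2).filter (fun B => z ∉ B) := by
  ext B
  rw [mem_indepSets, mem_filter, mem_indepSets, gr_contract']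
  constructor
  · rintro ⟨hB, hc, _⟩
    refine ⟨⟨hB.trans (erase_subset z _), hc, hs B (hB.trans (erase_subset z _)) (by omega)⟩, ?_⟩
    intro hz
    exact (mem_erase.1 (hB hz)).1 rfl
  · rintro ⟨⟨hB, hc, _⟩, hz⟩
    have hB' : B ⊆ (gr M).erase z := subset_erase.2 ⟨hB, hz⟩
    refine ⟨hB', hc, ?_⟩
    have := hN B (by rw [gr_contract']; exact hB') (by omega)
    exact this

/-- A simple matroid has as many independent singletons as elements. -/
theorem card_indepSets_one_of_simple {N : Matroid α} [N.Finite] (hN : Simple' N) :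
    (indepSets N 1).card = (gr N).card := by
  have : indepSets N 1 = (gr N).image (fun w => ({w} : Finset α)) := by
    ext B
    rw [mem_indepSets, mem_image]
    constructor
    · rintro ⟨hB, hc, _⟩
      obtain ⟨w, rfl⟩ := card_eq_one.1 hc
      exact ⟨w, singleton_subset_iff.1 hB, rfl⟩
    · rintro ⟨w, hw, rfl⟩
      exact ⟨singleton_subset_iff.2 hw, card_singleton w, hN {w} (singleton_subset_iff.2 hw) (by simp)⟩
  rw [this, card_image_of_injective _ singleton_injective]

/-- The demand of a pair `B ∌ z` in `M / z` at level `u − 1`, when the complement of `B` in `M` has rank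
`≥ u`: `C(ρ(E∖B) − 1, u − 3)`. -/
theorem demand_contract_eq {z : α} (hzi : M.Indep ({z} : Set α)) (hz : z ∈ gr M) {u : ℕ} (hu : 1 ≤ u)
    {B : Finset α} (hB : B ⊆ (gr M).erase z) (hrk : u ≤ rk M (gr M \ B)) :
    demand (M ／ ({z} : Set α)) 2 (u - 1) B = (rk M (gr M \ B) - 1).choose (u - 3) := by
  have hzB : z ∉ B := fun h => (mem_erase.1 (hB h)).1 rfl
  have hX : (gr M).erase z \ B ⊆ (gr M).erase z := sdiff_subset
  have h1 := rk_contract_add_one hzi hX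
  have e : insert z ((gr M).erase z \ B) = gr M \ B := by
    rw [erase_sdiff_comm, insert_erase (mem_sdiff.2 ⟨hz, hzB⟩)]
  rw [e] at h1
  unfold demand
  rw [gr_contract', if_pos (by omega), show u - 1 - 2 = u - 3 by omega]
  congr 1
  omega

/-- `rk Y ≤ rk X + 1` when `Y` exceeds `X` by at most one element. -/
theorem rk_le_rk_add_one_of_card_sdiff_le {X Y : Finset α} (hXY : X ⊆ Y) (h : (Y \ X).card ≤ 1) :
    rk M Y ≤ rk M X + 1 := by
  rcases Nat.le_one_iff_eq_zero_or_eq_one.1 h with h0 | h1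
  · rw [card_eq_zero, sdiff_eq_empty_iff_subset] at h0
    rw [subset_antisymm hXY h0]
    omega
  · obtain ⟨y, hy⟩ := card_eq_one.1 h1
    have hY : Y = insert y X := by
      ext x
      constructor
      · intro hx
        by_cases hxX : x ∈ X
        · exact mem_insert_of_mem hxX
        · have : x ∈ Y \ X := mem_sdiff.2 ⟨hx, hxX⟩
          rw [hy, mem_singleton] at this
          rw [this]; exact mem_insert_self y X
      · intro hx
        rcases mem_insert.1 hx with hxy | hx
        · have hyY : y ∈ Y \ X := by rw [hy]; exact mem_singleton_self y
          rw [hxy]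
          exact (mem_sdiff.1 hyY).1
        · exact hXY hx
    rw [hY]
    exact rk_insert_le y X

omit [DecidableEq α] in
/-- The independent pairs of a simple matroid are all pairs. -/
theorem indepSets_two_of_simple' {N : Matroid α} [N.Finite] (hN : Simple' N) :
    indepSets N 2 = (gr N).powersetCard 2 := by
  ext B
  rw [mem_indepSets, mem_powersetCard]
  constructor
  · rintro ⟨hB, hc, _⟩; exact ⟨hB, hc⟩
  · rintro ⟨hB, hc⟩; exact ⟨hB, hc, hN B hB (by omega)⟩

/-- **The deletion step from the induction hypothesis on the contraction, at an element in no 2-cocircuit.**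
`M` simple and coloop-free, `z` with every pair `{z, w}` of spanning complement and `M / z` simple,
`3 ≤ u ≤ ρ(E) − 1`, and `INDEP_{2,u−1}(M / z)`: then `DelStep M z u`. -/
theorem delStep_of_indep2_contract_noSeries (hs : Simple' M) (hg : CogirthGe' M 2) {z : α} (hz : z ∈ gr M)
    (hz2 : ∀ w ∈ gr M, w ≠ z → rk M (gr M \ {z, w}) = rk M (gr M))
    (hN : Simple' (M ／ ({z} : Set α))) {u : ℕ} (hu : 3 ≤ u) (huR : u + 1 ≤ rk M (gr M))
    (hI : Indep2 (M ／ ({z} : Set α)) (u - 1)) : DelStep M z u := by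
  classical
  set R := rk M (gr M) with hR
  have hzi : M.Indep (({z} : Finset α) : Set α) := hs {z} (singleton_subset_iff.2 hz) (by simp)
  have hzi' : M.Indep ({z} : Set α) := by rw [← coe_singleton]; exact hzi
  -- the pairs avoiding `z`
  set Pz := (indepSets M 2).filter (fun B => z ∉ B) with hPz
  -- (A) the complement of any pair has rank `≥ R − 1` (no coloops)
  have hA : ∀ B ∈ indepSets M 2, R - 1 ≤ rk M (gr M \ B) := by
    intro B hB
    rw [mem_indepSets] at hB
    obtain ⟨b, hb⟩ := card_pos.1 (by omega : 0 < B.card)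
    have hfull : rk M (gr M \ B.erase b) = R := by
      apply hg _ sdiff_subset
      rw [Finset.sdiff_sdiff_eq_self ((erase_subset b B).trans hB.1), card_erase_of_mem hb, hB.2.1]
      norm_num
    have hsub1 : ((gr M \ B.erase b) \ (gr M \ B)) ⊆ {b} := by
      intro x hx
      rw [mem_sdiff, mem_sdiff, mem_sdiff, mem_erase] at hx
      rw [mem_singleton]
      by_contra hxb
      exact hx.1.2 ⟨hxb, by_contra (fun h => hx.2 ⟨hx.1.1, h⟩)⟩
    have hcard1 : ((gr M \ B.erase b) \ (gr M \ B)).card ≤ 1 :=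
      (card_le_card hsub1).trans (by simp)
    have hle := rk_le_rk_add_one_of_card_sdiff_le (M := M)
      (sdiff_subset_sdiff (subset_refl _) (erase_subset b B)) hcard1
    omega
  -- (C) for a pair avoiding `z`, removing `z` from the complement keeps rank `≥ R − 1`
  have hC : ∀ B ∈ Pz, R - 1 ≤ rk M ((gr M \ B).erase z) := by
    intro B hB
    rw [hPz, mem_filter, mem_indepSets] at hB
    obtain ⟨⟨hBg, hBc, _⟩, hzB⟩ := hB
    obtain ⟨b, hb⟩ := card_pos.1 (by omega : 0 < B.card)
    have hbz : b ≠ z := fun h => hzB (h ▸ hb)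
    have hfull : rk M (gr M \ {z, b}) = R := hz2 b (hBg hb) hbz
    have hsub : (gr M \ B).erase z ⊆ gr M \ {z, b} := by
      intro x hx
      simp only [mem_erase, mem_sdiff] at hx
      simp only [mem_sdiff, mem_insert, mem_singleton, not_or]
      exact ⟨hx.2.1, hx.1, fun h => hx.2.2 (h ▸ hb)⟩
    have hsub2 : ((gr M \ {z, b}) \ (gr M \ B).erase z) ⊆ B.erase b := by
      intro x hx
      simp only [mem_sdiff, mem_insert, mem_singleton, not_or, mem_erase, not_and, not_not] at hx
      rw [mem_erase]
      exact ⟨hx.1.2.2, hx.2 hx.1.2.1 hx.1.1⟩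
    have hcard2 : ((gr M \ {z, b}) \ (gr M \ B).erase z).card ≤ 1 :=
      (card_le_card hsub2).trans (by rw [card_erase_of_mem hb, hBc])
    have hle := rk_le_rk_add_one_of_card_sdiff_le (M := M) hsub hcard2
    omega
  -- (B) the pairs through `z`: demand `C(R, u−2)` each, `m = |E| − 1` of them
  have hB : ∀ B ∈ (indepSets M 2).filter (fun B => z ∈ B), demand M 2 u B = R.choose (u - 2) := by
    intro B hB
    rw [mem_filter, mem_indepSets] at hB
    obtain ⟨⟨hBg, hBc, _⟩, hzB⟩ := hB
    obtain ⟨x, y, hxy, rfl⟩ := card_eq_two.1 hBc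
    have hfull : rk M (gr M \ {x, y}) = R := by
      rcases mem_insert.1 hzB with hzx | hzy
      · subst hzx
        exact hz2 y (hBg (mem_insert_of_mem (mem_singleton_self y))) (Ne.symm hxy)
      · rw [mem_singleton] at hzy
        subst hzy
        rw [pair_comm]
        exact hz2 x (hBg (mem_insert_self x _)) hxy
    unfold demand
    rw [hfull, if_pos (by omega)]
  set m := ((gr M).erase z).card with hmdef
  have hm : ((indepSets M 2).filter (fun B => z ∈ B)).card = m := by
    rw [card_pairs_through_eq_contract hs hz, card_indepSets_one_of_simple hN, gr_contract']
  -- `m ≥ R + 1`: the complement of a pair through `z` spans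
  have hmR : R + 1 ≤ m := by
    have hcard2 : 1 < (gr M).card := by
      have := rk_le_card (M := M) (gr M); omega
    obtain ⟨w, hw, hwz⟩ := exists_mem_ne hcard2 z
    have h1 := hz2 w hw hwz
    have h2 := rk_le_card (M := M) (gr M \ {z, w})
    have hsub : ({z, w} : Finset α) ⊆ gr M := by
      intro x hx
      rcases mem_insert.1 hx with hxz | hxw
      · rw [hxz]; exact hz
      · rw [mem_singleton] at hxw; rw [hxw]; exact hw
    rw [card_sdiff, inter_eq_left.2 hsub, card_pair (Ne.symm hwz)] at h2
    rw [hmdef, card_erase_of_mem hz]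
    omega
  -- (D) pairs avoiding `z`: the demand difference is `K = C(R−1,u−3)` exactly when `z` is a coloop of
  -- `M|(E∖B)`, and `0` otherwise
  set K := (R - 1).choose (u - 3) with hK
  set K2 := (R - 2).choose (u - 3) with hK2
  have hD : ∀ B ∈ Pz, demand M 2 u B ≤ demand (M ＼ ({z} : Set α)) 2 u B +
      (if rk M ((gr M \ B).erase z) < rk M (gr M \ B) then K else 0) := by
    intro B hB
    have hB' := hB
    rw [hPz, mem_filter] at hB'
    obtain ⟨hBi, hzB⟩ := hB'
    have hAB := hA B hBi
    have hCB := hC B hB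
    have hle : rk M (gr M \ B) ≤ R := rk_mono' sdiff_subset
    have hmono : rk M ((gr M \ B).erase z) ≤ rk M (gr M \ B) := rk_mono' (erase_subset z _)
    have hup : rk M (gr M \ B) ≤ rk M ((gr M \ B).erase z) + 1 := by
      apply rk_le_rk_add_one_of_card_sdiff_le (erase_subset z _)
      have hsub3 : ((gr M \ B) \ ((gr M \ B).erase z)) ⊆ {z} := by
        intro x hx
        rw [mem_sdiff, mem_erase, not_and] at hx
        rw [mem_singleton]
        by_contra hxz
        exact hx.2 hxz hx.1
      exact (card_le_card hsub3).trans (by simp)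
    have hdel : demand (M ＼ ({z} : Set α)) 2 u B = (rk M ((gr M \ B).erase z)).choose (u - 2) := by
      unfold demand
      rw [gr_delete', erase_sdiff_comm, rk_delete (erase_subset_erase z sdiff_subset), if_pos (by omega)]
    have hM : demand M 2 u B = (rk M (gr M \ B)).choose (u - 2) := by
      unfold demand
      rw [if_pos (by omega)]
    rw [hdel, hM]
    split_ifs with hlt
    · have h1 : rk M (gr M \ B) = R := by omega
      have h2 : rk M ((gr M \ B).erase z) = R - 1 := by omega
      rw [h1, h2, hK]
      have e := Nat.choose_succ_succ' (R - 1) (u - 3)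
      rw [show R - 1 + 1 = R by omega, show u - 3 + 1 = u - 2 by omega] at e
      rw [e]
      ring_nf
      omega
    · have : rk M ((gr M \ B).erase z) = rk M (gr M \ B) := by omega
      rw [this]
      omega
  set T := Pz.filter (fun B => rk M ((gr M \ B).erase z) < rk M (gr M \ B)) with hT
  have hDsum : ∑ B ∈ Pz, demand M 2 u B ≤
      ∑ B ∈ indepSets (M ＼ ({z} : Set α)) 2, demand (M ＼ ({z} : Set α)) 2 u B + T.card * K := by
    calc ∑ B ∈ Pz, demand M 2 u B
        ≤ ∑ B ∈ Pz, (demand (M ＼ ({z} : Set α)) 2 u B +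
            (if rk M ((gr M \ B).erase z) < rk M (gr M \ B) then K else 0)) := sum_le_sum hD
      _ = ∑ B ∈ Pz, demand (M ＼ ({z} : Set α)) 2 u B +
            ∑ B ∈ Pz, (if rk M ((gr M \ B).erase z) < rk M (gr M \ B) then K else 0) := sum_add_distrib
      _ = ∑ B ∈ indepSets (M ＼ ({z} : Set α)) 2, demand (M ＼ ({z} : Set α)) 2 u B + T.card * K := by
          rw [indepSets_delete_eq_filter, ← Finset.sum_filter, sum_const, smul_eq_mul]
  -- (E) the demand of `M / z` at level `u − 1` is at least `t·K + (P − t)·K₂`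
  have hPzN : indepSets (M ／ ({z} : Set α)) 2 = Pz := indepSets_contract_two_eq hs hN
  have hPcard : Pz.card = m.choose 2 := by
    rw [← hPzN, indepSets_two_of_simple' hN, card_powersetCard, gr_contract']
  have hE : T.card * K + (Pz.card - T.card) * K2 ≤
      ∑ B ∈ indepSets (M ／ ({z} : Set α)) 2, demand (M ／ ({z} : Set α)) 2 (u - 1) B := by
    rw [hPzN, ← sum_filter_add_sum_filter_not Pz (fun B => rk M ((gr M \ B).erase z) < rk M (gr M \ B))]
    have hT1 : ∀ B ∈ T, K ≤ demand (M ／ ({z} : Set α)) 2 (u - 1) B := by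
      intro B hB
      rw [hT, mem_filter] at hB
      have hB' := hB.1
      rw [hPz, mem_filter, mem_indepSets] at hB'
      have hBe : B ⊆ (gr M).erase z := subset_erase.2 ⟨hB'.1.1, hB'.2⟩
      rw [demand_contract_eq hzi' hz (by omega) hBe (by have := hA B (by rw [hPz, mem_filter] at hB; exact hB.1.1); omega)]
      have hCB := hC B hB.1
      have hle : rk M (gr M \ B) ≤ R := rk_mono' sdiff_subset
      have : rk M (gr M \ B) - 1 = R - 1 := by omega
      rw [this]
    have hT2 : ∀ B ∈ Pz.filter (fun B => ¬ rk M ((gr M \ B).erase z) < rk M (gr M \ B)),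
        K2 ≤ demand (M ／ ({z} : Set α)) 2 (u - 1) B := by
      intro B hB
      rw [mem_filter] at hB
      have hB' := hB.1
      rw [hPz, mem_filter, mem_indepSets] at hB'
      have hBe : B ⊆ (gr M).erase z := subset_erase.2 ⟨hB'.1.1, hB'.2⟩
      rw [demand_contract_eq hzi' hz (by omega) hBe (by have := hA B (by rw [hPz, mem_filter] at hB; exact hB.1.1); omega)]
      apply Nat.choose_le_choose
      have := hA B (by rw [hPz, mem_filter] at hB; exact hB.1.1)
      omega
    have hc : (Pz.filter (fun B => ¬ rk M ((gr M \ B).erase z) < rk M (gr M \ B))).card = Pz.card - T.card := by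
      have := card_filter_add_card_filter_not (s := Pz) (fun B => rk M ((gr M \ B).erase z) < rk M (gr M \ B))
      rw [← hT] at this
      omega
    calc T.card * K + (Pz.card - T.card) * K2
        = ∑ B ∈ T, K + ∑ B ∈ Pz.filter (fun B => ¬ rk M ((gr M \ B).erase z) < rk M (gr M \ B)), K2 := by
          rw [sum_const, sum_const, smul_eq_mul, smul_eq_mul, hc]
      _ ≤ _ := Nat.add_le_add (sum_le_sum hT1) (sum_le_sum hT2)
  -- (F) the induction hypothesis
  have hF : ∑ B ∈ indepSets (M ／ ({z} : Set α)) 2, demand (M ／ ({z} : Set α)) 2 (u - 1) B ≤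
      (u - 1).choose 2 * (indepSets (M ／ ({z} : Set α)) (u - 1)).card := hI
  have hEF := hE.trans hF
  -- (G) assemble
  unfold DelStep
  rw [← sum_filter_add_sum_filter_not (indepSets M 2) (fun B => z ∈ B), sum_const_nat hB, hm,
    card_indepSetsThrough_eq_contract hs hz (by omega)]
  have hTle : T.card ≤ Pz.card := card_filter_le _ _
  have h2P : 2 * m.choose 2 = m * (m - 1) := by
    rw [Nat.choose_two_right]
    exact Nat.two_mul_div_two_of_even (Nat.even_mul_pred_self m)
  have hI1 : (u - 2) * R.choose (u - 2) = R * K := by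
    have := Nat.add_one_mul_choose_eq (R - 1) (u - 3)
    rw [show R - 1 + 1 = R by omega, show u - 3 + 1 = u - 2 by omega] at this
    rw [hK]; linarith
  have hI2 : (R - 1) * K2 = (R - u + 2) * K := by
    have := Nat.choose_mul_succ_eq (R - 2) (u - 3)
    rw [show R - 2 + 1 = R - 1 by omega, show R - 1 - (u - 3) = R - u + 2 by omega] at this
    rw [hK, hK2]; linarith
  have hI3 : (u - 2) * u.choose 2 = u * (u - 1).choose 2 := sub_two_mul_choose_two u (by omega)
  have harith := arith_ih_core hu huR hmR hTle (by rw [hPcard]; exact h2P)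
  -- the final inequality, times `(R − 1)(u − 2) > 0`
  set I := (indepSets (M ／ ({z} : Set α)) (u - 1)).card with hIdef
  set t := T.card with htdef
  set P := Pz.card with hPdef
  set CR := R.choose (u - 2) with hCR
  set Cu := u.choose 2 with hCu
  set Cu1 := (u - 1).choose 2 with hCu1
  have key : (R - 1) * (u - 2) * (m * CR + t * K) ≤ (R - 1) * (u - 2) * (Cu * I) := by
    calc (R - 1) * (u - 2) * (m * CR + t * K)
        = (R - 1) * (m * ((u - 2) * CR) + (u - 2) * t * K) := by ring
      _ = (R - 1) * (m * (R * K) + (u - 2) * t * K) := by rw [hI1]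
      _ = ((R - 1) * m * R + (R - 1) * (u - 2) * t) * K := by ring
      _ ≤ (u * (R - 1) * t + u * (R - u + 2) * (P - t)) * K := Nat.mul_le_mul_right _ harith
      _ = u * (R - 1) * t * K + u * (P - t) * ((R - u + 2) * K) := by ring
      _ = u * (R - 1) * t * K + u * (P - t) * ((R - 1) * K2) := by rw [hI2]
      _ = (R - 1) * u * (t * K + (P - t) * K2) := by ring
      _ ≤ (R - 1) * u * (Cu1 * I) := Nat.mul_le_mul_left _ hEF
      _ = (R - 1) * ((u * Cu1) * I) := by ring
      _ = (R - 1) * (((u - 2) * Cu) * I) := by rw [← hI3]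
      _ = (R - 1) * (u - 2) * (Cu * I) := by ring
  have hpos : 0 < (R - 1) * (u - 2) := Nat.mul_pos (by omega) (by omega)
  have hfin : m * CR + t * K ≤ Cu * I := Nat.le_of_mul_le_mul_left key hpos
  calc m * CR + ∑ B ∈ Pz, demand M 2 u B
      ≤ m * CR + (∑ B ∈ indepSets (M ＼ ({z} : Set α)) 2, demand (M ＼ ({z} : Set α)) 2 u B + t * K) :=
        Nat.add_le_add_left hDsum _
    _ = ∑ B ∈ indepSets (M ＼ ({z} : Set α)) 2, demand (M ＼ ({z} : Set α)) 2 u B + (m * CR + t * K) := by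
        ring
    _ ≤ ∑ B ∈ indepSets (M ＼ ({z} : Set α)) 2, demand (M ＼ ({z} : Set α)) 2 u B + Cu * I :=
        Nat.add_le_add_left hfin _



end PercRepro.Cogirth
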